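import Mathlib
import HarnessLib

/-!
# Elementary inequalities for the Gevrey induction
# (stub `stub_gevreyInduction`, line `Sketch`, crux `SuperExponentialEnergyTails`, stmt-AtomisticToContinuum-17701), stage 1/4

Pure real analysis over Mathlib (no moment system, no measure theory).  The abstract Gevrey induction
`GevreyInduction` (support file `…SuperExponentialEnergyTailsDefsB`, §5) turns a family of continuous moment
functions with Povzner balance inequalities into the Gevrey class `C Aᵏ (k!)^{3/2} ≤ C Aᵏ k^{3k/2}` by an
order-by-order maximum principle (Bobylev 1997 / Desvillettes 1993 moment method for hard spheres, no generating
functions).  This first stage records the constants-only tools: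

* `exp_neg_one_mul_pow_le_factorial` (`(k/e)ᵏ ≤ k!`), its Gevrey form `gevrey_root_le`
  (`(e^{-3/4} k^{3/4})^{2k} ≤ (k!)^{3/2}`) and `root_level_le` (`C Aᵏ (k!)^{3/2} < y ⇒ √A e^{-3/4} k^{3/4} ≤ y^{1/(2k)}`):
  the Stirling-type lower bound that makes the super-linear loss win by `k^{3/4}`;
* the binomial algebra of the class `Xᵢ = C Aⁱ (i!)^{3/2}`: `choose_mul_rpow_factorial`
  (`C(k,j) (j!)^{3/2} ((k-j)!)^{3/2} = (k!)^{3/2} / √C(k,j)`), `sqrt_class_mul_class_succ_le`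
  (`√(X_j X_{j+1}) ≤ C A^j √A (j!)^{3/2} k^{3/4}` for `j + 1 ≤ k`) and `min_cast_nonneg`;
* the combinatorial bound killing the middle of the gain sum: `four_pow_min_le_choose`
  (`4^i ≤ (2i+1) C(k,j)`, `i = min j (k-j)`, from the central binomial coefficient), `inv_sqrt_choose_le`,
  `weight_div_sqrt_choose_le`, and the registered stub `gevreyCombinatorialBound`:
  `∑_{0<j<k} (1 + min(j,k-j))^q / √C(k,j) ≤ σ_q` uniformly in `k`.

prover-line-stmt-AtomisticToContinuum-17701-0 (stub worker `stub_gevreyInduction`).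
-/

noncomputable section

namespace Summit.AtomisticToContinuum.HydrodynamicLimit.Theorems.SuperExponentialEnergyTailsGevreyInductionPrelim

open scoped BigOperators

/-! ## §1 Stirling-type lower bound for the factorial -/

/-- `(e⁻¹ k)ᵏ ≤ k!` (from `kᵏ/k! ≤ eᵏ`, Mathlib's `Real.pow_div_factorial_le_exp` at `x = k`). [folklore] -/
theorem exp_neg_one_mul_pow_le_factorial (k : ℕ) : (Real.exp (-1) * k) ^ k ≤ (k.factorial : ℝ) := by
  have h : (k : ℝ) ^ k ≤ (k.factorial : ℝ) * Real.exp k := by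
    have h := Real.pow_div_factorial_le_exp (k : ℝ) (Nat.cast_nonneg k) k
    have hf : (0 : ℝ) < k.factorial := by exact_mod_cast k.factorial_pos
    have := (div_le_iff₀ hf).1 h
    linarith
  have he : Real.exp (-1) ^ k * Real.exp k = 1 := by
    rw [← Real.exp_nat_mul, ← Real.exp_add]
    simp
  calc (Real.exp (-1) * k) ^ k = Real.exp (-1) ^ k * (k : ℝ) ^ k := mul_pow _ _ _
    _ ≤ Real.exp (-1) ^ k * ((k.factorial : ℝ) * Real.exp k) := by gcongr
    _ = (k.factorial : ℝ) * (Real.exp (-1) ^ k * Real.exp k) := by ring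
    _ = (k.factorial : ℝ) := by rw [he, mul_one]

/-- **Gevrey root bound**: `(e^{-3/4} k^{3/4})^{2k} ≤ (k!)^{3/2}`, i.e. `(k!)^{3/(4k)} ≥ (k/e)^{3/4}`; this is what makes
the loss `K₁ m_{2k}^{1+1/(2k)}` beat the gain at the level `C Aᵏ (k!)^{3/2}` by a factor `k^{3/4}`. [folklore] -/
theorem gevrey_root_le (k : ℕ) :
    (Real.exp (-3 / 4) * (k : ℝ) ^ ((3 : ℝ) / 4)) ^ (2 * k) ≤ (k.factorial : ℝ) ^ ((3 : ℝ) / 2) := by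
  have hk : (0 : ℝ) ≤ k := Nat.cast_nonneg k
  have he : (0 : ℝ) ≤ Real.exp (-1) * k := by positivity
  have e1 : Real.exp (-3 / 4) * (k : ℝ) ^ ((3 : ℝ) / 4) = (Real.exp (-1) * k) ^ ((3 : ℝ) / 4) := by
    rw [Real.mul_rpow (Real.exp_pos _).le hk, ← Real.exp_mul]
    norm_num
  have e2 : (3 : ℝ) / 4 * ((2 * k : ℕ) : ℝ) = ((k : ℕ) : ℝ) * ((3 : ℝ) / 2) := by
    push_cast
    ring
  rw [e1, ← Real.rpow_natCast, ← Real.rpow_mul he, e2, Real.rpow_natCast_mul he]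
  exact Real.rpow_le_rpow (by positivity) (exp_neg_one_mul_pow_le_factorial k) (by norm_num)

/-- **Root of the Gevrey level.**  If `C ≥ 1`, `A ≥ 0` and `C Aᵏ (k!)^{3/2} < y` then
`√A · e^{-3/4} k^{3/4} ≤ y^{1/(2k)}` (`gevrey_root_le`: `(√A e^{-3/4} k^{3/4})^{2k} ≤ Aᵏ (k!)^{3/2}`). [folklore] -/
theorem root_level_le {C A y : ℝ} (hC : 1 ≤ C) (hA : 0 ≤ A) {k : ℕ} (hk : 1 ≤ k)
    (hy : C * A ^ k * (k.factorial : ℝ) ^ ((3 : ℝ) / 2) < y) :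
    Real.sqrt A * (Real.exp (-3 / 4) * (k : ℝ) ^ ((3 : ℝ) / 4)) ≤ y ^ (1 / (2 * (k : ℝ))) := by
  set b : ℝ := Real.sqrt A * (Real.exp (-3 / 4) * (k : ℝ) ^ ((3 : ℝ) / 4)) with hb
  have hb0 : 0 ≤ b := by positivity
  have hF0 : 0 ≤ (k.factorial : ℝ) ^ ((3 : ℝ) / 2) := by positivity
  have hbk : b ^ (2 * k) ≤ y := by
    have h1 : b ^ (2 * k) = A ^ k * (Real.exp (-3 / 4) * (k : ℝ) ^ ((3 : ℝ) / 4)) ^ (2 * k) := by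
      rw [hb, mul_pow, pow_mul, Real.sq_sqrt hA]
    have h2 : A ^ k * (Real.exp (-3 / 4) * (k : ℝ) ^ ((3 : ℝ) / 4)) ^ (2 * k)
        ≤ A ^ k * (k.factorial : ℝ) ^ ((3 : ℝ) / 2) :=
      mul_le_mul_of_nonneg_left (gevrey_root_le k) (by positivity)
    have h3 : A ^ k * (k.factorial : ℝ) ^ ((3 : ℝ) / 2) ≤ C * A ^ k * (k.factorial : ℝ) ^ ((3 : ℝ) / 2) := by
      have : 0 ≤ A ^ k * (k.factorial : ℝ) ^ ((3 : ℝ) / 2) := by positivity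
      nlinarith
    linarith
  have hy0 : 0 ≤ y := le_trans (by positivity) hbk
  have e : (1 / (2 * (k : ℝ))) = (((2 * k : ℕ) : ℝ))⁻¹ := by
    push_cast
    ring
  calc b = (b ^ (2 * k)) ^ (((2 * k : ℕ) : ℝ))⁻¹ := (Real.pow_rpow_inv_natCast hb0 (by omega)).symm
    _ ≤ y ^ (((2 * k : ℕ) : ℝ))⁻¹ := Real.rpow_le_rpow (by positivity) hbk (by positivity)
    _ = y ^ (1 / (2 * (k : ℝ))) := by rw [e]

/-! ## §2 Binomial algebra of the Gevrey class `C Aⁱ (i!)^{3/2}` -/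

/-- `C(k,j) · (j!)^{3/2} · ((k-j)!)^{3/2} = (k!)^{3/2} / √C(k,j)` for `j ≤ k`. [folklore] -/
theorem choose_mul_rpow_factorial {k j : ℕ} (hjk : j ≤ k) :
    (k.choose j : ℝ) * ((j.factorial : ℝ) ^ ((3 : ℝ) / 2) * ((k - j).factorial : ℝ) ^ ((3 : ℝ) / 2))
      = (k.factorial : ℝ) ^ ((3 : ℝ) / 2) / Real.sqrt (k.choose j) := by
  have hc : (0 : ℝ) < k.choose j := by exact_mod_cast Nat.choose_pos hjk
  have hfac : (k.factorial : ℝ) = (k.choose j : ℝ) * j.factorial * (k - j).factorial := by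
    exact_mod_cast (Nat.choose_mul_factorial_mul_factorial hjk).symm
  have h32 : (k.choose j : ℝ) * (k.choose j : ℝ) ^ ((1 : ℝ) / 2) = (k.choose j : ℝ) ^ ((3 : ℝ) / 2) := by
    rw [← Real.rpow_one_add' hc.le (by norm_num)]
    norm_num
  rw [eq_div_iff (Real.sqrt_pos.2 hc).ne', Real.sqrt_eq_rpow, hfac,
    Real.mul_rpow (by positivity) (by positivity), Real.mul_rpow (by positivity) (by positivity), ← h32]
  ring

/-- For the class `Xᵢ = C Aⁱ (i!)^{3/2}` and `j + 1 ≤ k`: `√(X_j X_{j+1}) ≤ C Aʲ √A (j!)^{3/2} k^{3/4}` (log-convexity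
slack of the factorial class: `(j+1)! = (j+1) j!` and `(j+1)^{3/2} ≤ k^{3/2}`). [folklore] -/
theorem sqrt_class_mul_class_succ_le {C A : ℝ} (hC : 0 ≤ C) (hA : 0 ≤ A) {j k : ℕ} (hjk : j + 1 ≤ k) :
    Real.sqrt ((C * A ^ j * (j.factorial : ℝ) ^ ((3 : ℝ) / 2)) *
        (C * A ^ (j + 1) * ((j + 1).factorial : ℝ) ^ ((3 : ℝ) / 2)))
      ≤ C * A ^ j * Real.sqrt A * (j.factorial : ℝ) ^ ((3 : ℝ) / 2) * (k : ℝ) ^ ((3 : ℝ) / 4) := by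
  rw [Real.sqrt_le_iff]
  refine ⟨by positivity, ?_⟩
  rw [Nat.factorial_succ, Nat.cast_mul, Real.mul_rpow (by positivity) (by positivity)]
  have h1 : ((j + 1 : ℕ) : ℝ) ^ ((3 : ℝ) / 2) ≤ ((k : ℝ) ^ ((3 : ℝ) / 4)) ^ 2 := by
    rw [← Real.rpow_natCast, ← Real.rpow_mul (Nat.cast_nonneg k)]
    norm_num
    exact Real.rpow_le_rpow (by positivity) (by exact_mod_cast hjk) (by norm_num)
  have h2 : Real.sqrt A ^ 2 = A := Real.sq_sqrt hA
  set F : ℝ := (j.factorial : ℝ) ^ ((3 : ℝ) / 2)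
  calc C * A ^ j * F * (C * A ^ (j + 1) * (((j + 1 : ℕ) : ℝ) ^ ((3 : ℝ) / 2) * F))
        = (C * A ^ j * F) ^ 2 * A * ((j + 1 : ℕ) : ℝ) ^ ((3 : ℝ) / 2) := by ring
    _ ≤ (C * A ^ j * F) ^ 2 * A * ((k : ℝ) ^ ((3 : ℝ) / 4)) ^ 2 := by gcongr
    _ = (C * A ^ j * F) ^ 2 * Real.sqrt A ^ 2 * ((k : ℝ) ^ ((3 : ℝ) / 4)) ^ 2 := by rw [h2]
    _ = (C * A ^ j * Real.sqrt A * F * (k : ℝ) ^ ((3 : ℝ) / 4)) ^ 2 := by ring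

/-- `0 ≤ min ↑j (↑k - ↑j)` for `j ≤ k` (the real `min` carried by the balance of `MomentSystem`). [folklore] -/
theorem min_cast_nonneg {j k : ℕ} (hjk : j ≤ k) : 0 ≤ min (j : ℝ) ((k : ℝ) - j) := by
  rw [le_min_iff]
  have : (j : ℝ) ≤ k := by exact_mod_cast hjk
  exact ⟨by positivity, by linarith⟩

/-! ## §3 The combinatorial bound: the binomial kills the middle of the gain sum -/

/-- `4^i ≤ (2i+1) · C(k,j)` for `j < k`, `i = min j (k-j)`: `C(k,j) = C(k,i) ≥ C(2i,i) ≥ 4^i/(2i+1)`. [folklore] -/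
theorem four_pow_min_le_choose (k j : ℕ) (hjk : j < k) :
    4 ^ (min j (k - j)) ≤ (2 * min j (k - j) + 1) * k.choose j := by
  rcases le_total j (k - j) with h | h
  · rw [min_eq_left h]
    calc 4 ^ j ≤ (2 * j + 1) * (2 * j).choose j := Nat.four_pow_le_two_mul_add_one_mul_central_binom j
      _ ≤ (2 * j + 1) * k.choose j := Nat.mul_le_mul_left _ (Nat.choose_le_choose j (by omega))
  · rw [min_eq_right h]
    calc 4 ^ (k - j) ≤ (2 * (k - j) + 1) * (2 * (k - j)).choose (k - j) :=
          Nat.four_pow_le_two_mul_add_one_mul_central_binom _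
      _ ≤ (2 * (k - j) + 1) * k.choose (k - j) := Nat.mul_le_mul_left _ (Nat.choose_le_choose _ (by omega))
      _ = (2 * (k - j) + 1) * k.choose j := by rw [Nat.choose_symm hjk.le]

/-- `1/√C(k,j) ≤ (2i+1)/2^i` for `j < k`, `i = min j (k-j)`. [folklore] -/
theorem inv_sqrt_choose_le (k j : ℕ) (hjk : j < k) :
    1 / Real.sqrt (k.choose j) ≤ (2 * (min j (k - j) : ℕ) + 1 : ℝ) / 2 ^ (min j (k - j)) := by
  set i := min j (k - j) with hi
  have h4 : (4 : ℝ) ^ i ≤ (2 * i + 1) * k.choose j := by exact_mod_cast four_pow_min_le_choose k j hjk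
  have hc : (0 : ℝ) < k.choose j := by exact_mod_cast Nat.choose_pos hjk.le
  rw [div_le_div_iff₀ (Real.sqrt_pos.mpr hc) (by positivity), one_mul]
  refine le_of_pow_le_pow_left₀ two_ne_zero (by positivity) ?_
  have e4 : ((2 : ℝ) ^ i) ^ 2 = 4 ^ i := by
    rw [← pow_mul, mul_comm, pow_mul]
    norm_num
  rw [e4, mul_pow, Real.sq_sqrt hc.le]
  have h1 : (2 * i + 1 : ℝ) ≤ (2 * i + 1) ^ 2 := by nlinarith
  nlinarith

/-- **Summable majorant of the weights.**  For `j < k` and `i = min j (k-j)`: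
`(1 + i)^q / √C(k,j) ≤ 2 (i+1)^{q+1} / 2^i`. [folklore] -/
theorem weight_div_sqrt_choose_le (q k j : ℕ) (hjk : j < k) :
    (1 + (min j (k - j) : ℕ) : ℝ) ^ q / Real.sqrt (k.choose j)
      ≤ 2 * ((min j (k - j) : ℕ) + 1 : ℝ) ^ (q + 1) / 2 ^ (min j (k - j)) := by
  set i := min j (k - j) with hi
  have h := inv_sqrt_choose_le k j hjk
  rw [← hi] at h
  have hw : (0 : ℝ) ≤ (1 + (i : ℝ)) ^ q := by positivity
  calc (1 + (i : ℝ)) ^ q / Real.sqrt (k.choose j) = (1 + (i : ℝ)) ^ q * (1 / Real.sqrt (k.choose j)) := by ring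
    _ ≤ (1 + (i : ℝ)) ^ q * ((2 * (i : ℝ) + 1) / 2 ^ i) := by gcongr
    _ ≤ (1 + (i : ℝ)) ^ q * ((2 * ((i : ℝ) + 1)) / 2 ^ i) := by gcongr; linarith
    _ = 2 * ((i : ℝ) + 1) ^ (q + 1) / 2 ^ i := by ring

/-- **The combinatorial bound of the Gevrey induction.**  For every `q` there is `σ > 0` with
`∑_{0<j<k} (1 + min(j, k-j))^q / √C(k,j) ≤ σ` for all `k` (the sum is even `O(k^{-1/2})`; boundedness suffices):
each term is at most `g(min(j,k-j)) ≤ g(j) + g(k-j)` with `g(i) = 2(i+1)^{q+1} 2^{-i}` summable, and the reflected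
sum equals the direct one.  The real `min ↑j (↑k - ↑j)` is the form the balance of `MomentSystem` carries.
(Registered stub `gevreyCombinatorialBound` of this support file.) [folklore] -/
theorem gevreyCombinatorialBound : ∀ q : ℕ, ∃ σ : ℝ, 0 < σ ∧ ∀ k : ℕ, ∑ j ∈ Finset.Ioo 0 k, (1 + min (j : ℝ) ((k : ℝ) - j)) ^ q / Real.sqrt (k.choose j) ≤ σ := by
  intro q
  set g : ℕ → ℝ := fun i => 2 * ((i : ℝ) + 1) ^ (q + 1) / 2 ^ i with hg
  have hg0 : ∀ i, 0 ≤ g i := fun i => by positivity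
  have hgs : Summable g := by
    have h1 : Summable (fun n : ℕ => (n : ℝ) ^ (q + 1) * (1 / 2 : ℝ) ^ n) :=
      summable_pow_mul_geometric_of_norm_lt_one (q + 1) (by norm_num)
    have h2 := ((summable_nat_add_iff 1).mpr h1).mul_left 4
    refine h2.congr fun i => ?_
    simp only [hg, Nat.cast_add, Nat.cast_one, one_div, inv_pow, pow_succ]
    field_simp
    ring
  refine ⟨2 * ∑' i, g i + 1, by positivity, fun k => ?_⟩
  have hterm : ∀ j ∈ Finset.Ioo 0 k,
      (1 + min (j : ℝ) ((k : ℝ) - j)) ^ q / Real.sqrt (k.choose j) ≤ g j + g (k - j) := by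
    intro j hj
    rw [Finset.mem_Ioo] at hj
    have hmin : min (j : ℝ) ((k : ℝ) - j) = ((min j (k - j) : ℕ) : ℝ) := by
      rw [Nat.cast_min, Nat.cast_sub hj.2.le]
    have hw := weight_div_sqrt_choose_le q k j hj.2
    rw [hmin]
    refine hw.trans ?_
    rcases le_total j (k - j) with h | h
    · rw [min_eq_left h]
      linarith [hg0 (k - j)]
    · rw [min_eq_right h]
      show g (k - j) ≤ g j + g (k - j)
      linarith [hg0 j]
  have hrefl : ∑ j ∈ Finset.Ioo 0 k, g (k - j) = ∑ j ∈ Finset.Ioo 0 k, g j := by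
    refine Finset.sum_nbij' (fun j => k - j) (fun j => k - j) ?_ ?_ ?_ ?_ ?_
    · intro a ha
      rw [Finset.mem_Ioo] at ha ⊢
      omega
    · intro a ha
      rw [Finset.mem_Ioo] at ha ⊢
      omega
    · intro a ha
      rw [Finset.mem_Ioo] at ha
      show k - (k - a) = a
      omega
    · intro a ha
      rw [Finset.mem_Ioo] at ha
      show k - (k - a) = a
      omega
    · intro a _
      rfl
  have hle : ∑ j ∈ Finset.Ioo 0 k, g j ≤ ∑' i, g i := hgs.sum_le_tsum _ (fun i _ => hg0 i)
  calc ∑ j ∈ Finset.Ioo 0 k, (1 + min (j : ℝ) ((k : ℝ) - j)) ^ q / Real.sqrt (k.choose j)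
        ≤ ∑ j ∈ Finset.Ioo 0 k, (g j + g (k - j)) := Finset.sum_le_sum hterm
    _ = ∑ j ∈ Finset.Ioo 0 k, g j + ∑ j ∈ Finset.Ioo 0 k, g (k - j) := Finset.sum_add_distrib
    _ = 2 * ∑ j ∈ Finset.Ioo 0 k, g j := by rw [hrefl]; ring
    _ ≤ 2 * ∑' i, g i + 1 := by linarith

end Summit.AtomisticToContinuum.HydrodynamicLimit.Theorems.SuperExponentialEnergyTailsGevreyInductionPrelim

end
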